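/-
Copyright: b2b-lace packet (tail-bound analyst, gen 8).  THE SIGNED-INJECTION LAW of the `W_d`-orbit sum at an
ARBITRARY lattice point: for `x` supported on the image of an injection `ι : α ↪ [d]` (`|α| = m`) and EVERY `f`,
  `(2^d d!)⁻¹ Σ_{ρ ∈ W_d} f(x − ρx) = (2^m d!/(d−m)!)⁻¹ Σ_{κ : α ↪ [d]} Σ_{s : α → {±1}} f(x − κ_*(s·x))`,
whence `W_{n,j}(x)` and `L_n(x)` at any node (e.g. `2e₁+e₂`, `m = 2`: `4·d(d−1)` terms) as a DECIDABLE finite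
sum of shell integrals.  d-generic; no numeral; no `sorry`.
-/
import Literature.Probability.FitznerVanDerHofstad2017.SrwOrbitShellLaw
import Literature.Probability.FitznerVanDerHofstad2017.SrwIntegralJCone
import HarnessLib

/-!
# The signed-injection law of the orbit sum `Σ_{ρ ∈ W_d} f(x − ρx)`

CITATION HEADER (PLACEMENT v2). This module is part of a certified REPRODUCTION of:
R. Fitzner, R. van der Hofstad, *Mean-field behavior for nearest-neighbor percolation in d > 10*,
Electron. J. Probab. 22 (2017), no. 43 [FvdH17], and *Generalized approach to the non-backtracking lace
expansion*, Probab. Theory Related Fields 169 (2017) 1041–1119 [NoBLE17-I] (arXiv:1506.07977, 1506.07969).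
Reproduces: the ENUMERATION behind the notebook cells `L[n,x]`, `K[n,l,x]` of `SRW.nb` §2 at a general
lattice point — the placement formula (5.16) p. 1092,
`W_{n,j}(x) = |W_d|⁻¹ Σ_{ρ ∈ W_d} I_{n,2j}(x − ρx)`, `ρx = p(x; ν, δ)` (Def. 2.5 p. 1058), rewritten as an
average over the `2^m · d!/(d−m)!` SIGNED INJECTIONS of the support of `x` (the b2b-lace engine-B
"signed_injections" evaluation: 22 / 440 / 7920 terms at `d = 11` for `|supp x| = 1, 2, 3`).
Origin: build `lace`, (S2b)-IMPR-L8 (GAPS I4: kernel cell values of the `T/U` tables at the nodes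
`2e₁+e₂`, `e₁+e₂+e₃`, … which are NOT scaled indicator vectors and hence outside `SrwOrbitShellLaw`),
tail-bound analyst gen 8 (unit b2b-lace-tail-g8); companion of `SrwIntegralSortedMonotone` (the node
families) and `SrwOrbitShellLaw` (the law at `c·1_S`).

## The observation ([folklore] counting)

For `ρ = (ν, δ)`, `(x − ρx)_μ = x_μ − δ_μ x_{ν μ}` and `x_{ν μ} ≠ 0` only if `ν μ ∈ supp x ⊆ ι(α)`.  Hence
`x − ρx` depends on `ρ` only through the ORBIT DATUM `(κ, s)`, `κ = ν⁻¹ ∘ ι : α ↪ [d]`,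
`s = δ ∘ κ : α → {±1}`: `ρx = κ_*(s·x)` with `(κ_*(s·x))_{κ i} = s_i x_{ι i}` and `0` off `κ(α)`
(`spAct_eq_sgnInjVec`).  The map `ρ ↦ (κ, s)` has fibres permuted transitively by right multiplications
(`sgnInjOf_transitive`, via `Equiv.Perm.exists_extending_pair`), so the averaging principle
`sum_comp_div_card_eq_of_transitive` of `SrwOrbitShellLaw` gives the law with
`#((α ↪ [d]) × (α → ℤˣ)) = d!/(d−m)! · 2^m` (`Fintype.card_embedding_eq`).

## What is here (all `d`-generic)

* `sgnInjVec κ s a` — the placed signed copy `κ_*(s·a)`; `sgnInjOf ι ρ` — the orbit datum of `ρ`;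
* `spAct_eq_sgnInjVec`, `sgnInjOf_transitive`, `card_sgnInj_real`;
* **`orbitSum_eq_sum_sgnInj`** — the signed-injection law for every `f : ℤ^d → ℝ` (no invariance needed);
* **`srwW_eq_sum_sgnInj`**, **`srwL_eq_sum_sgnInj`** — `W_{n,j}(x)`, `L_n(x)` (`d ≥ 2n+1`) as the finite average;
  `srwW_le_of_sgnInjBound` — the table form (any termwise majorant of the shell integrals);
* `srwW_vecOfParts_eq_sum_sgnInj` — the same at a zero-padded node `vecOfParts d p` (`p` a list of parts,
  `ι` = the initial-segment embedding), the shape in which certificate files name nodes.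

## What is NOT here
No dimension, no table, no numeric value; nothing cited beyond the tree's (5.16) (`srwW_eq_orbit_sum`).

## References
* [NoBLE17-I] R. Fitzner, R. van der Hofstad, PTRF 169 (2017) 1041–1119; arXiv:1506.07969 — Def. 2.5
  p. 1058 (`p(x;ν,δ)`), (5.16) p. 1092; notebook `SRW.nb` §2 (arXiv:1506.07977 anc), cells `L[n_,x_]`,
  `K[n_,l_,x_]`.
-/

namespace Literature.Probability.FitznerVanDerHofstad2017

open Finset

variable {d : ℕ}

section SgnInjVec

variable {α : Type*}

/-- The placed signed copy `κ_*(s·a) ∈ ℤ^d`: value `s_i a_i` at `κ i`, `0` off the image of `κ`.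
[cite: FitznerVanDerHofstad2016NoBLE, Def. 2.5 p. 1058] -/
def sgnInjVec [Fintype α] (κ : α ↪ Fin d) (s : α → ℤˣ) (a : α → ℤ) : Fin d → ℤ :=
  fun μ => ∑ i, if κ i = μ then (s i : ℤ) * a i else 0

/-- Value of `κ_*(s·a)` at a point of the image. [folklore] -/
theorem sgnInjVec_apply_image [Fintype α] (κ : α ↪ Fin d) (s : α → ℤˣ) (a : α → ℤ) (i : α) :
    sgnInjVec κ s a (κ i) = (s i : ℤ) * a i := by
  unfold sgnInjVec
  rw [Finset.sum_eq_single i]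
  · rw [if_pos rfl]
  · intro i' _ hi'
    rw [if_neg fun h => hi' (κ.injective h)]
  · intro h
    exact absurd (Finset.mem_univ i) h

/-- Value of `κ_*(s·a)` off the image. [folklore] -/
theorem sgnInjVec_apply_of_not_image [Fintype α] (κ : α ↪ Fin d) (s : α → ℤˣ) (a : α → ℤ) (μ : Fin d)
    (hμ : ∀ i, κ i ≠ μ) : sgnInjVec κ s a μ = 0 := by
  unfold sgnInjVec
  exact Finset.sum_eq_zero fun i _ => if_neg (hμ i)

/-- The ORBIT DATUM of `ρ = (ν, δ)` relative to `ι : α ↪ [d]`: the injection `κ = ν⁻¹ ∘ ι` and the signs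
`s = δ ∘ κ`. [folklore] -/
def sgnInjOf (ι : α ↪ Fin d) (ρ : SgnPermPair d) : (α ↪ Fin d) × (α → ℤˣ) :=
  (ι.trans ρ.1.symm.toEmbedding, fun i => ρ.2 (ρ.1.symm (ι i)))

/-- Components of the orbit datum. [folklore] -/
theorem sgnInjOf_fst_apply (ι : α ↪ Fin d) (ρ : SgnPermPair d) (i : α) :
    (sgnInjOf ι ρ).1 i = ρ.1.symm (ι i) := rfl

/-- Components of the orbit datum. [folklore] -/
theorem sgnInjOf_snd_apply (ι : α ↪ Fin d) (ρ : SgnPermPair d) (i : α) :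
    (sgnInjOf ι ρ).2 i = ρ.2 (ρ.1.symm (ι i)) := rfl

/-- **`ρx` is a function of the orbit datum**: for `x` supported on `ι(α)`,
`p(x; ν, δ) = κ_*(s·x)` with `(κ, s) = sgnInjOf ι (ν, δ)`. [cite: FitznerVanDerHofstad2016NoBLE, Def. 2.5 p. 1058] -/
theorem spAct_eq_sgnInjVec [Fintype α] (ι : α ↪ Fin d) (x : Fin d → ℤ) (hx : ∀ μ, (∀ i, ι i ≠ μ) → x μ = 0)
    (ρ : SgnPermPair d) :
    spAct ρ x = sgnInjVec (sgnInjOf ι ρ).1 (sgnInjOf ι ρ).2 fun i => x (ι i) := by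
  funext μ
  rw [spAct_apply]
  by_cases h : ∃ i, ι i = ρ.1 μ
  · obtain ⟨i, hi⟩ := h
    have hκ : (sgnInjOf ι ρ).1 i = μ := by
      rw [sgnInjOf_fst_apply, hi, Equiv.symm_apply_apply]
    rw [← hκ, sgnInjVec_apply_image, hκ, sgnInjOf_snd_apply, hi, Equiv.symm_apply_apply]
  · push Not at h
    rw [hx (ρ.1 μ) h, mul_zero, sgnInjVec_apply_of_not_image]
    intro i hi
    rw [sgnInjOf_fst_apply] at hi
    exact h i (by rw [← hi, Equiv.apply_symm_apply])

/-- The fibres of `ρ ↦ sgnInjOf ι ρ` are permuted transitively by self-bijections of `W_d`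
(right multiplication by a permutation extending `κ ↦ κ'` and a sign correction). [folklore] -/
theorem sgnInjOf_transitive [Fintype α] (ι : α ↪ Fin d) (b b' : (α ↪ Fin d) × (α → ℤˣ)) :
    ∃ e : SgnPermPair d ≃ SgnPermPair d, ∀ ρ, sgnInjOf ι (e ρ) = b' ↔ sgnInjOf ι ρ = b := by
  classical
  obtain ⟨κ, s⟩ := b
  obtain ⟨κ', s'⟩ := b'
  obtain ⟨σ, hσ⟩ := Equiv.Perm.exists_extending_pair κ κ' κ.injective κ'.injective
  let ε : Fin d → ℤˣ := fun μ => ∏ i, if κ' i = μ then s' i * (s i)⁻¹ else 1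
  have hε : ∀ i, ε (κ' i) = s' i * (s i)⁻¹ := by
    intro i
    show (∏ i', if κ' i' = κ' i then s' i' * (s i')⁻¹ else 1) = _
    rw [Finset.prod_eq_single i]
    · rw [if_pos rfl]
    · intro i' _ hi'
      rw [if_neg fun h => hi' (κ'.injective h)]
    · intro h
      exact absurd (Finset.mem_univ i) h
  let e : SgnPermPair d ≃ SgnPermPair d :=
    Equiv.prodCongr (Equiv.mulRight σ⁻¹)
      ((Equiv.arrowCongr σ (Equiv.refl ℤˣ)).trans (Equiv.mulRight ε))
  have he1 : ∀ (ρ : SgnPermPair d) (y : Fin d), (e ρ).1.symm y = σ (ρ.1.symm y) := by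
    intro ρ y
    show (ρ.1 * σ⁻¹).symm y = σ (ρ.1.symm y)
    rw [Equiv.symm_apply_eq, Equiv.Perm.mul_apply, Equiv.Perm.inv_def, Equiv.symm_apply_apply,
      Equiv.apply_symm_apply]
  have he2 : ∀ (ρ : SgnPermPair d) (y : Fin d), (e ρ).2 y = ρ.2 (σ.symm y) * ε y := fun ρ y => rfl
  have key : ∀ a b c : ℤˣ, a * (b * c⁻¹) = b ↔ a = c := by decide
  refine ⟨e, fun ρ => ?_⟩
  simp only [Prod.ext_iff, DFunLike.ext_iff, funext_iff, sgnInjOf_fst_apply, sgnInjOf_snd_apply, he1, he2,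
    Equiv.symm_apply_apply]
  constructor
  · rintro ⟨hA, hB⟩
    have hA0 : ∀ i, ρ.1.symm (ι i) = κ i := fun i =>
      σ.injective ((hA i).trans (hσ i).symm)
    refine ⟨hA0, fun i => ?_⟩
    have h := hB i
    rw [hA0 i, hσ i, hε i, key] at h
    rw [hA0 i]
    exact h
  · rintro ⟨hA, hB⟩
    refine ⟨fun i => by rw [hA i, hσ i], fun i => ?_⟩
    have h := hB i
    rw [hA i] at h
    rw [hA i, hσ i, hε i, key]
    exact h

/-- `#((α ↪ [d]) × (α → ℤˣ)) = d!/(d−m)! · 2^m`, `m = |α|` (as a real). [folklore] -/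
theorem card_sgnInj_real [Fintype α] [DecidableEq α] :
    (Fintype.card ((α ↪ Fin d) × (α → ℤˣ)) : ℝ) =
      (d.descFactorial (Fintype.card α) : ℝ) * 2 ^ Fintype.card α := by
  classical
  rw [Fintype.card_prod, Fintype.card_embedding_eq, Fintype.card_fin, Fintype.card_fun,
    Fintype.card_units_int]
  push_cast
  ring

/-- **The signed-injection law.**  For `x` supported on `ι(α)` and EVERY `f : ℤ^d → ℝ`:
`(2^d d!)⁻¹ Σ_{ρ ∈ W_d} f(x − ρx) = (d!/(d−m)! · 2^m)⁻¹ Σ_{κ : α ↪ [d]} Σ_{s : α → ℤˣ} f(x − κ_*(s·x))`.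
[cite: FitznerVanDerHofstad2016NoBLE, (5.16) p. 1092] -/
theorem orbitSum_eq_sum_sgnInj [Fintype α] [DecidableEq α] (ι : α ↪ Fin d) (x : Fin d → ℤ) (hx : ∀ μ, (∀ i, ι i ≠ μ) → x μ = 0)
    (f : (Fin d → ℤ) → ℝ) :
    (∑ ρ : SgnPermPair d, f (x - spAct ρ x)) / (2 ^ d * (d.factorial : ℝ)) =
      (∑ κ : α ↪ Fin d, ∑ s : α → ℤˣ, f (x - sgnInjVec κ s fun i => x (ι i))) /
        ((d.descFactorial (Fintype.card α) : ℝ) * 2 ^ Fintype.card α) := by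
  classical
  haveI : Nonempty ((α ↪ Fin d) × (α → ℤˣ)) := ⟨(ι, fun _ => 1)⟩
  have hF : ∀ ρ : SgnPermPair d, f (x - spAct ρ x) =
      (fun b : (α ↪ Fin d) × (α → ℤˣ) => f (x - sgnInjVec b.1 b.2 fun i => x (ι i))) (sgnInjOf ι ρ) := by
    intro ρ
    simp only [spAct_eq_sgnInjVec ι x hx ρ]
  set F : (α ↪ Fin d) × (α → ℤˣ) → ℝ := fun b => f (x - sgnInjVec b.1 b.2 fun i => x (ι i)) with hFdef
  have step : (∑ ρ : SgnPermPair d, F (sgnInjOf ι ρ)) / (Fintype.card (SgnPermPair d) : ℝ) =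
      (∑ b, F b) / (Fintype.card ((α ↪ Fin d) × (α → ℤˣ)) : ℝ) :=
    sum_comp_div_card_eq_of_transitive (sgnInjOf ι) (sgnInjOf_transitive ι) F
  rw [← card_sgnPermPair_real, sum_congr rfl fun ρ _ => hF ρ, step, card_sgnInj_real,
    Fintype.sum_prod_type]

/-- **`W_{n,j}(x)` as the signed-injection average** (`d ≥ 2n+1`):
`W_{n,j}(x) = (d!/(d−m)! · 2^m)⁻¹ Σ_{κ, s} I_{n,2j}(x − κ_*(s·x))`.
[cite: FitznerVanDerHofstad2016NoBLE, (5.16) p. 1092] -/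
theorem srwW_eq_sum_sgnInj [Fintype α] [DecidableEq α] {n : ℕ} (hd : 2 * n + 1 ≤ d) (j : ℕ)
    (ι : α ↪ Fin d) (x : Fin d → ℤ)
    (hx : ∀ μ, (∀ i, ι i ≠ μ) → x μ = 0) :
    srwW d n j x =
      (∑ κ : α ↪ Fin d, ∑ s : α → ℤˣ, srwI d n (2 * j) (x - sgnInjVec κ s fun i => x (ι i))) /
        ((d.descFactorial (Fintype.card α) : ℝ) * 2 ^ Fintype.card α) := by
  rw [srwW_eq_orbit_sum hd j x, orbitSum_eq_sum_sgnInj ι x hx]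

/-- **`L_n(x)` as the signed-injection average** (`d ≥ 2n+1`).
[cite: FitznerVanDerHofstad2016NoBLE, (2.19) p. 1058, (5.16) p. 1092] -/
theorem srwL_eq_sum_sgnInj [Fintype α] [DecidableEq α] {n : ℕ} (hd : 2 * n + 1 ≤ d) (ι : α ↪ Fin d) (x : Fin d → ℤ)
    (hx : ∀ μ, (∀ i, ι i ≠ μ) → x μ = 0) :
    srwL d n x =
      (∑ κ : α ↪ Fin d, ∑ s : α → ℤˣ, srwI d n 0 (x - sgnInjVec κ s fun i => x (ι i))) /
        ((d.descFactorial (Fintype.card α) : ℝ) * 2 ^ Fintype.card α) := by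
  rw [← srwW_zero, srwW_eq_sum_sgnInj hd 0 ι x hx, Nat.mul_zero]

/-- **Table form**: any termwise majorant `B(κ, s) ≥ I_{n,2j}(x − κ_*(s·x))` of the shell integrals gives
`W_{n,j}(x) ≤ (d!/(d−m)! · 2^m)⁻¹ Σ_{κ, s} B(κ, s)`. [cite: FitznerVanDerHofstad2016NoBLE, (5.16) p. 1092] -/
theorem srwW_le_of_sgnInjBound [Fintype α] [DecidableEq α] {n : ℕ} (hd : 2 * n + 1 ≤ d) (j : ℕ)
    (ι : α ↪ Fin d) (x : Fin d → ℤ)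
    (hx : ∀ μ, (∀ i, ι i ≠ μ) → x μ = 0) (B : (α ↪ Fin d) → (α → ℤˣ) → ℝ)
    (hB : ∀ κ s, srwI d n (2 * j) (x - sgnInjVec κ s fun i => x (ι i)) ≤ B κ s) :
    srwW d n j x ≤
      (∑ κ : α ↪ Fin d, ∑ s : α → ℤˣ, B κ s) /
        ((d.descFactorial (Fintype.card α) : ℝ) * 2 ^ Fintype.card α) := by
  rw [srwW_eq_sum_sgnInj hd j ι x hx]
  exact div_le_div_of_nonneg_right
    (sum_le_sum fun κ _ => sum_le_sum fun s _ => hB κ s) (by positivity)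

end SgnInjVec

/-! ### Nodes given as zero-padded lists of parts -/

/-- A zero-padded node `vecOfParts d p` vanishes off the initial segment `{μ < |p|}`. [folklore] -/
theorem vecOfParts_apply_of_le (p : List ℕ) (μ : Fin d) (hμ : p.length ≤ (μ : ℕ)) :
    vecOfParts d p μ = 0 := by
  simp only [vecOfParts]
  rw [List.getD_eq_getElem?_getD, List.getElem?_eq_none hμ]
  rfl

/-- On the initial segment the node's entries are the parts. [folklore] -/
theorem vecOfParts_apply_castLE (p : List ℕ) (hp : p.length ≤ d) (i : Fin p.length) :
    vecOfParts d p (Fin.castLE hp i) = (p.get i : ℤ) := by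
  simp only [vecOfParts, Fin.val_castLE]
  rw [List.getD_eq_getElem?_getD, List.getElem?_eq_getElem i.isLt, Option.getD_some,
    List.get_eq_getElem]

/-- **`W_{n,j}` at a node given by a list of parts** `p = [p₀, …, p_{m−1}]` (`m ≤ d`, `d ≥ 2n+1`):
`W_{n,j}(p₀, …, p_{m−1}, 0, …, 0) = (d!/(d−m)! · 2^m)⁻¹ Σ_{κ : [m] ↪ [d]} Σ_{s ∈ {±1}^m} I_{n,2j}(x − κ_*(s·p))`
— e.g. `2e₁+e₂ = vecOfParts d [2,1]`: `4·d(d−1)` shell integrals.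
[cite: FitznerVanDerHofstad2016NoBLE, (5.16) p. 1092] -/
theorem srwW_vecOfParts_eq_sum_sgnInj {n : ℕ} (hd : 2 * n + 1 ≤ d) (j : ℕ) (p : List ℕ)
    (hp : p.length ≤ d) :
    srwW d n j (vecOfParts d p) =
      (∑ κ : Fin p.length ↪ Fin d, ∑ s : Fin p.length → ℤˣ,
          srwI d n (2 * j) (vecOfParts d p - sgnInjVec κ s fun i => (p.get i : ℤ))) /
        ((d.descFactorial p.length : ℝ) * 2 ^ p.length) := by
  have hx : ∀ μ : Fin d, (∀ i : Fin p.length, Fin.castLEEmb hp i ≠ μ) → vecOfParts d p μ = 0 := by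
    intro μ hμ
    apply vecOfParts_apply_of_le
    by_contra hlt
    exact hμ ⟨(μ : ℕ), by omega⟩ (Fin.ext rfl)
  have hfun : (fun i => vecOfParts d p ((Fin.castLEEmb hp) i)) = fun i => (p.get i : ℤ) :=
    funext fun i => vecOfParts_apply_castLE p hp i
  have h := srwW_eq_sum_sgnInj hd j (Fin.castLEEmb hp) (vecOfParts d p) hx
  rw [hfun, Fintype.card_fin] at h
  exact h

/-- The same for `L_n`. [cite: FitznerVanDerHofstad2016NoBLE, (2.19) p. 1058, (5.16) p. 1092] -/
theorem srwL_vecOfParts_eq_sum_sgnInj {n : ℕ} (hd : 2 * n + 1 ≤ d) (p : List ℕ) (hp : p.length ≤ d) :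
    srwL d n (vecOfParts d p) =
      (∑ κ : Fin p.length ↪ Fin d, ∑ s : Fin p.length → ℤˣ,
          srwI d n 0 (vecOfParts d p - sgnInjVec κ s fun i => (p.get i : ℤ))) /
        ((d.descFactorial p.length : ℝ) * 2 ^ p.length) := by
  rw [← srwW_zero, srwW_vecOfParts_eq_sum_sgnInj hd 0 p hp, Nat.mul_zero]

end Literature.Probability.FitznerVanDerHofstad2017
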